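import Summits.QuantumAdvantage.QuantumAdvantage.Theorems.WalkTwoStepLocalEngineRegimes

/-!
# (G♯) local engine — part 3/3 — §6 the pinned dichotomy: pins, parts, effective cuts, `SparsePinned` / `DensePinned` (OPEN), `nearRegime_of`, `twoStepFreeRungFive_of`

VERBATIM split (for the 400-line rule) of planner qa-qnc0-p2 g24's checked skeleton `HOME/qa-qnc0-p2/line24/LocalEngine.lean`
(sha16 `7aa61edea42d6c70`, 1013 lines, farm rc 0 / 0 sorry / 0 warnings; authored AND proved by the planner seat; landed by
qn-prover-3 g15, ask P2-24b, `--supports stmt-QuantumAdvantage-23121` = rung (G♯) `OddPrimeWalk.TwoStepFreeRungFive`) into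
`WalkTwoStepLocalEngine{Core,Regimes,Glue}.lean` (+ `WalkTwoStepOddRow.lean`); only the file boundaries, the per-file preambles,
these header lines and one-line docstrings on the planner's undocumented auxiliary lemmas (lint) are new.
WHAT THIS IS: the PROVED glue of the three-regime plan (double count of discordant corner flips, pigeonhole on popular split
positions, flip invariance, `FarLocal → FarHeavy`, per-class composition, pinned parts and `SparsePinned → DensePinned → NearRegime`,
`twoStepFreeRungFive_of : FarLocal 5 → SparsePinned 5 → DensePinned 5 → <item 23121 signature>`), with the three regime lemmas
`FarLocal`, `SparsePinned`, `DensePinned` as OPEN `def … : Prop` (route-posited statements, not Literature facts; plans in their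
docstrings and in HOME/qa-qnc0-p2/ROUND-24.md §1ter).  WHAT THIS IS NOT: no proof of the three regime lemmas, hence no proof of
(G♯) yet; nothing about `LinSel`/R5; separation NOT moved.
-/

namespace Summit.QuantumAdvantage.AdviceFreeQNC0.LocalEngine

open Finset Classical
open Summit.QuantumAdvantage.AdviceFreeQNC0.Coset21.RungG (classOf)

/-! ### §6 The pinned dichotomy behind R2' (`NearRegime`): pins, parts, effective cuts; the two branch statements
`SparsePinned` / `DensePinned` (OPEN) and the bookkeeping `nearRegime_of` (PROVED, with `Equidist` from rung (G)). -/

section Pinned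

variable {p n : ℕ}

/-- the far-split times, as elements of `Fin (n+1)` (a far cut has `s_g ≤ n − p`, so `% (n+1)` is faithful). -/
noncomputable def pinTimes (S : TwoStep p n) (d₀ : ℕ) : Finset (Fin (n + 1)) :=
  (univ.filter fun g : Fin (n + 1) => Far S d₀ g).image
    fun g => (⟨S.s g % (n + 1), Nat.mod_lt _ (Nat.succ_pos n)⟩ : Fin (n + 1))

/-- Auxiliary `pinTimes_card_le` of the (G♯) local engine (planner qa-qnc0-p2 g24, `LocalEngine.lean`, verbatim; part 3). -/
theorem pinTimes_card_le (S : TwoStep p n) (d₀ : ℕ) : (pinTimes S d₀).card ≤ farCount S d₀ :=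
  Finset.card_image_le

/-- boundary coordinates: the first `p` and the last `p`. -/
def bdry (p n : ℕ) : Finset (Fin n) := univ.filter fun i : Fin n => i.val < p ∨ n ≤ i.val + p

/-- Auxiliary `bdry_card_le` of the (G♯) local engine (planner qa-qnc0-p2 g24, `LocalEngine.lean`, verbatim; part 3). -/
theorem bdry_card_le (p n : ℕ) : (bdry p n).card ≤ 2 * p := by
  have h1 : ((univ : Finset (Fin n)).filter fun i : Fin n => i.val < p).card ≤ p := by
    have h := Finset.card_le_card_of_injOn (s := (univ : Finset (Fin n)).filter fun i : Fin n => i.val < p)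
      (t := Finset.range p) (fun i : Fin n => i.val) ?_ ?_
    · simpa using h
    · intro i hi
      simp only [Finset.coe_filter, Finset.mem_univ, true_and, Set.mem_setOf_eq] at hi
      simpa using hi
    · intro i _ j _ h
      exact Fin.ext h
  have h2 : ((univ : Finset (Fin n)).filter fun i : Fin n => n ≤ i.val + p).card ≤ p := by
    have h := Finset.card_le_card_of_injOn (s := (univ : Finset (Fin n)).filter fun i : Fin n => n ≤ i.val + p)
      (t := Finset.range p) (fun i : Fin n => n - 1 - i.val) ?_ ?_
    · simpa using h
    · intro i hi
      simp only [Finset.coe_filter, Finset.mem_univ, true_and, Set.mem_setOf_eq] at hi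
      simp only [Finset.coe_range, Set.mem_Iio]
      have := i.isLt
      omega
    · intro i _ j _ h
      have := i.isLt; have := j.isLt
      apply Fin.ext
      simp only at h
      omega
  have e : bdry p n = ((univ : Finset (Fin n)).filter fun i : Fin n => i.val < p)
      ∪ ((univ : Finset (Fin n)).filter fun i : Fin n => n ≤ i.val + p) := by
    ext i; simp [bdry, Finset.mem_union, Finset.mem_filter]
  rw [e]
  exact le_trans (Finset.card_union_le _ _) (by omega)

/-- the pin key of an input: the residues `N(τ) mod p` at the far-split times and the boundary bits. -/
noncomputable def pinKey (S : TwoStep p n) (d₀ : ℕ) (u : Fin n → Bool) : (Fin (n + 1) → ZMod p) × (Fin n → Bool) :=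
  (fun τ => if τ ∈ pinTimes S d₀ then ((wtPrefix u τ.val : ℕ) : ZMod p) else 0,
   fun i => if i ∈ bdry p n then u i else false)

/-- the PART of the class `w` containing `u₀` (same pin key). -/
noncomputable def part (S : TwoStep p n) (d₀ : ℕ) (w : ZMod p) (u₀ : Fin n → Bool) : Finset (Fin n → Bool) :=
  (classOf p w : Finset (Fin n → Bool)).filter fun u => pinKey S d₀ u = pinKey S d₀ u₀

/-- winners inside a part. -/
noncomputable def winPart (c : ℕ) (S : TwoStep p n) (d₀ : ℕ) (w : ZMod p) (u₀ : Fin n → Bool) : Finset (Fin n → Bool) :=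
  (part S d₀ w u₀).filter fun u => ringWinU c S.y u = true

/-- status of cut `g` on input `u` (fires and is live). -/
def status (c : ℕ) (S : TwoStep p n) (g : Fin (n + 1)) (u : Fin n → Bool) : Bool :=
  S.y g u && decide ((c + g.val + walkExp u g.val) % 3 ≠ 0)

/-- number of cuts EFFECTIVE on `Q` (non-constant status on `Q`); cuts constant on `Q` are invisible to both branches. -/
noncomputable def effOn (c : ℕ) (S : TwoStep p n) (Q : Finset (Fin n → Bool)) : ℕ :=
  (univ.filter fun g : Fin (n + 1) => ∃ u ∈ Q, ∃ v ∈ Q, status c S g u ≠ status c S g v).card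

end Pinned

/-- **R2'-sparse (pinned free window + three lifts; port of `WalkFiniteStateRungSparse`)**: if a window of length `m` fits between
the observation times of the cuts effective on the part, the pinned times and the boundary, then `win ∩ Q ≤ (2/3 + ε)|Q|`
(the lifts `r, r+p, r+2p` preserve the part: boundary bits untouched, pinned residues shift by multiples of `p`; cuts constant on
`Q` stay constant on the lifts because the lifts lie in `Q`). -/
def SparsePinned (p : ℕ) : Prop :=
  ∀ ε : ℝ, 0 < ε → ∃ m : ℕ, 0 < m ∧ ∀ (n c d₀ : ℕ) (S : TwoStep p n) (w : ZMod p) (u₀ : Fin n → Bool),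
    (2 * effOn c S (part S d₀ w u₀) + (pinTimes S d₀).card + 2 * p + 1) * m ≤ n →
      ((winPart c S d₀ w u₀).card : ℝ) ≤ (2 / 3 + ε) * ((part S d₀ w u₀).card : ℝ)

/-- **R2'-dense (block contraction on the enlarged state `ℤ_{3p} × {0,1}^{d₀}` + block non-degeneracy (N1))**: on a part, the
bias decays exponentially in the number of effective cuts, at a price `K` per pinned time (spoiled blocks; boundary blocks and the
two lone split-observables of the cuts at positions `0`, `n` are absorbed in `C`). -/
def DensePinned (p : ℕ) : Prop :=
  ∀ d₀ : ℕ, ∃ δ : ℝ, 0 ≤ δ ∧ δ < 1 ∧ ∃ K : ℝ, 1 ≤ K ∧ ∃ C : ℝ, 0 ≤ C ∧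
    ∀ (n c : ℕ) (S : TwoStep p n) (w : ZMod p) (u₀ : Fin n → Bool),
      |((winPart c S d₀ w u₀).card : ℝ) - ((part S d₀ w u₀).card : ℝ) / 2|
        ≤ C * (2 : ℝ) ^ n * δ ^ (effOn c S (part S d₀ w u₀)) * K ^ ((pinTimes S d₀).card)

section PinnedGlue

variable {p n : ℕ}

/-- the number of parts of a class: `≤ p^{#pins} · 4^p`. -/
theorem card_keys_le [NeZero p] (S : TwoStep p n) (d₀ : ℕ) (w : ZMod p) :
    ((classOf p w : Finset (Fin n → Bool)).image (pinKey S d₀)).card ≤ p ^ (pinTimes S d₀).card * 2 ^ (2 * p) := by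
  set T := pinTimes S d₀ with hT
  set A : Finset (Fin (n + 1) → ZMod p) := univ.filter fun f => ∀ τ, τ ∉ T → f τ = 0 with hA
  set B : Finset (Fin n → Bool) := univ.filter fun b => ∀ i, i ∉ bdry p n → b i = false with hB
  have hsub : (classOf p w : Finset (Fin n → Bool)).image (pinKey S d₀) ⊆ A ×ˢ B := by
    intro k hk
    obtain ⟨u, -, rfl⟩ := Finset.mem_image.mp hk
    simp only [Finset.mem_product, hA, hB, Finset.mem_filter, Finset.mem_univ, true_and, pinKey]
    refine ⟨fun τ hτ => ?_, fun i hi => ?_⟩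
    · exact if_neg hτ
    · simp [hi]
  have hAc : A.card ≤ p ^ T.card := by
    have h := Finset.card_le_card_of_injOn (s := A) (t := (univ : Finset (T → ZMod p)))
      (fun f => fun τ : T => f τ.1) (fun _ _ => Finset.mem_coe.mpr (Finset.mem_univ _)) ?_
    · have e : (univ : Finset (T → ZMod p)).card = p ^ T.card := by
        rw [Finset.card_univ, Fintype.card_fun, ZMod.card, Fintype.card_coe]
      rw [e] at h
      exact h
    · intro f hf g hg hfg
      simp only [hA, Finset.coe_filter, Finset.mem_univ, true_and, Set.mem_setOf_eq] at hf hg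
      funext τ
      by_cases hτ : τ ∈ T
      · exact congr_fun hfg ⟨τ, hτ⟩
      · rw [hf τ hτ, hg τ hτ]
  have hBc : B.card ≤ 2 ^ (2 * p) := by
    have h := Finset.card_le_card_of_injOn (s := B) (t := (univ : Finset (bdry p n → Bool)))
      (fun b => fun i : bdry p n => b i.1) (fun _ _ => Finset.mem_coe.mpr (Finset.mem_univ _)) ?_
    · have e : (univ : Finset (bdry p n → Bool)).card = 2 ^ (bdry p n).card := by
        rw [Finset.card_univ, Fintype.card_fun, Fintype.card_bool, Fintype.card_coe]
      rw [e] at h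
      exact le_trans h (Nat.pow_le_pow_right (by norm_num) (bdry_card_le p n))
    · intro f hf g hg hfg
      simp only [hB, Finset.coe_filter, Finset.mem_univ, true_and, Set.mem_setOf_eq] at hf hg
      funext i
      by_cases hi : i ∈ bdry p n
      · exact congr_fun hfg ⟨i, hi⟩
      · rw [hf i hi, hg i hi]
  calc (((classOf p w : Finset (Fin n → Bool)).image (pinKey S d₀)).card)
      ≤ (A ×ˢ B).card := Finset.card_le_card hsub
    _ = A.card * B.card := Finset.card_product _ _
    _ ≤ p ^ T.card * 2 ^ (2 * p) := Nat.mul_le_mul hAc hBc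

/-- Auxiliary `winIn_filter_key` of the (G♯) local engine (planner qa-qnc0-p2 g24, `LocalEngine.lean`, verbatim; part 3). -/
theorem winIn_filter_key (c : ℕ) (S : TwoStep p n) (d₀ : ℕ) (w : ZMod p) (u₀ : Fin n → Bool) :
    (winIn c S w).filter (fun u => pinKey S d₀ u = pinKey S d₀ u₀) = winPart c S d₀ w u₀ := by
  ext u
  simp only [winIn, winPart, part, Coset21.RungG.classOf, Finset.mem_filter, Finset.mem_univ, true_and]
  tauto

end PinnedGlue


section NearGlue

/-- **R2' from the two pinned branches**: bookkeeping over the parts of a class (`#parts ≤ p^{#pins}·4^p`, `Equidist` for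
`|class| ≥ 2ⁿ/(2p)`); constants: `r` with `δ^r·p·K ≤ 1`, `q₀` with `C·4^p·δ^{q₀} ≤ 1/(16p)`, `φ = 1/(2m(2r+1))`, `θ₂ = 7/8`. -/
theorem nearRegime_of (p : ℕ) [Fact p.Prime] (hS : SparsePinned p) (hD : DensePinned p) : NearRegime p := by
  haveI : NeZero p := ⟨(Fact.out : p.Prime).ne_zero⟩
  have hp2 : 2 ≤ p := (Fact.out : p.Prime).two_le
  have hp0 : (0 : ℝ) < p := by exact_mod_cast (Fact.out : p.Prime).pos
  intro d₀
  obtain ⟨δ, hδ0, hδ1, K, hK, C, hC, hD⟩ := hD d₀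
  obtain ⟨m, hm, hS⟩ := hS (1 / 12) (by norm_num)
  obtain ⟨ρ, hρ0, hρ1, hEq⟩ := Coset21.RungG.stub_equidist p hp2
  obtain ⟨nₑ, hnₑ⟩ : ∃ nₑ : ℕ, ρ ^ nₑ < 1 / (2 * p) := exists_pow_lt_of_lt_one (by positivity) hρ1
  obtain ⟨r, hr⟩ : ∃ r : ℕ, δ ^ r < 1 / (p * K) := exists_pow_lt_of_lt_one (by positivity) hδ1
  obtain ⟨q₀, hq₀⟩ : ∃ q₀ : ℕ, δ ^ q₀ < 1 / (16 * p * (C + 1) * 4 ^ p) :=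
    exists_pow_lt_of_lt_one (by positivity) hδ1
  have hm0 : (0 : ℝ) < m := by exact_mod_cast hm
  refine ⟨1 / (2 * m * (2 * r + 1)), by positivity, 7 / 8, by norm_num,
    max nₑ (2 * (2 * m * q₀ + (2 * p + 1) * m)), fun n hn c S w hfar => ?_⟩
  have hne : nₑ ≤ n := le_trans (le_max_left _ _) hn
  have hn2 : 2 * (2 * m * q₀ + (2 * p + 1) * m) ≤ n := le_trans (le_max_right _ _) hn
  set P : ℕ := (pinTimes S d₀).card with hPdef
  -- pins < φ n, as naturals: P · (2 m (2r+1)) < n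
  have hPφ : (P : ℝ) * (2 * m * (2 * r + 1)) < n := by
    have h1 : (P : ℝ) ≤ (farCount S d₀ : ℝ) := by exact_mod_cast pinTimes_card_le S d₀
    have h2 : (P : ℝ) < 1 / (2 * m * (2 * r + 1)) * n := lt_of_le_of_lt h1 hfar
    have hpos : (0 : ℝ) < 2 * m * (2 * r + 1) := by positivity
    calc (P : ℝ) * (2 * m * (2 * r + 1)) < 1 / (2 * m * (2 * r + 1)) * n * (2 * m * (2 * r + 1)) :=
          mul_lt_mul_of_pos_right h2 hpos
      _ = n := by field_simp
  have hPφN : P * (2 * m * (2 * r + 1)) < n := by exact_mod_cast hPφ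
  -- the common error term of a dense part
  set err : ℝ := C * (2 : ℝ) ^ n * δ ^ q₀ * (δ ^ r * K) ^ P with herr
  have hK0 : 0 ≤ K := by linarith
  have herr0 : 0 ≤ err := by positivity
  have hδrK : δ ^ r * K * p ≤ 1 := by
    have hpK : (0 : ℝ) < p * K := by positivity
    have h := hr.le
    rw [le_div_iff₀ hpK] at h
    linarith [show δ ^ r * K * p = δ ^ r * (p * K) by ring]
  -- class and parts
  set cls := (classOf p w : Finset (Fin n → Bool)) with hclsdef
  set keys := cls.image (pinKey S d₀) with hkeys
  have hper : ∀ k ∈ keys, (((winIn c S w).filter fun u => pinKey S d₀ u = k).card : ℝ)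
      ≤ 3 / 4 * ((cls.filter fun u => pinKey S d₀ u = k).card : ℝ) + err := by
    intro k hk
    obtain ⟨u₀, -, rfl⟩ := Finset.mem_image.mp hk
    rw [winIn_filter_key]
    change ((winPart c S d₀ w u₀).card : ℝ) ≤ 3 / 4 * ((part S d₀ w u₀).card : ℝ) + err
    have hQ0 : (0 : ℝ) ≤ ((part S d₀ w u₀).card : ℝ) := Nat.cast_nonneg _
    set E : ℕ := effOn c S (part S d₀ w u₀) with hEdef
    by_cases hsp : (2 * E + P + 2 * p + 1) * m ≤ n
    · have h : ((winPart c S d₀ w u₀).card : ℝ) ≤ (2 / 3 + 1 / 12) * ((part S d₀ w u₀).card : ℝ) :=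
        hS n c d₀ S w u₀ hsp
      linarith
    · push Not at hsp
      -- dense: E ≥ r P + q₀
      have hE : r * P + q₀ ≤ E := by
        have h4 : 4 * m * (r * P + q₀) + 3 ≤ 4 * m * E := by
          have e1 : n + 1 ≤ (2 * E + P + 2 * p + 1) * m := hsp
          nlinarith
        by_contra hcon
        push Not at hcon
        have hcon' : E + 1 ≤ r * P + q₀ := hcon
        have h5 : 4 * m * (E + 1) ≤ 4 * m * (r * P + q₀) := Nat.mul_le_mul_left _ hcon'
        nlinarith
      have hDb : |((winPart c S d₀ w u₀).card : ℝ) - ((part S d₀ w u₀).card : ℝ) / 2|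
          ≤ C * (2 : ℝ) ^ n * δ ^ E * K ^ P := hD n c S w u₀
      have hpow : δ ^ E * K ^ P ≤ δ ^ q₀ * (δ ^ r * K) ^ P := by
        have h1 : δ ^ E ≤ δ ^ (r * P + q₀) := pow_le_pow_of_le_one hδ0 hδ1.le hE
        have h2 : δ ^ (r * P + q₀) * K ^ P = δ ^ q₀ * (δ ^ r * K) ^ P := by
          rw [pow_add, pow_mul, mul_pow]; ring
        have hKP : 0 ≤ K ^ P := pow_nonneg hK0 _
        calc δ ^ E * K ^ P ≤ δ ^ (r * P + q₀) * K ^ P := mul_le_mul_of_nonneg_right h1 hKP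
          _ = δ ^ q₀ * (δ ^ r * K) ^ P := h2
      have h32 : 0 ≤ C * (2 : ℝ) ^ n := by positivity
      have hbias : |((winPart c S d₀ w u₀).card : ℝ) - ((part S d₀ w u₀).card : ℝ) / 2| ≤ err :=
        calc |((winPart c S d₀ w u₀).card : ℝ) - ((part S d₀ w u₀).card : ℝ) / 2|
            ≤ C * (2 : ℝ) ^ n * δ ^ E * K ^ P := hDb
          _ = C * (2 : ℝ) ^ n * (δ ^ E * K ^ P) := by ring
          _ ≤ C * (2 : ℝ) ^ n * (δ ^ q₀ * (δ ^ r * K) ^ P) := mul_le_mul_of_nonneg_left hpow h32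
          _ = err := by rw [herr]; ring
      linarith [(abs_le.mp hbias).2]
  -- sums over parts
  have hwinN : (winIn c S w).card = ∑ k ∈ keys, ((winIn c S w).filter fun u => pinKey S d₀ u = k).card :=
    Finset.card_eq_sum_card_fiberwise (f := pinKey S d₀) fun u hu =>
      Finset.mem_image_of_mem _ (Finset.mem_filter.mpr ⟨Finset.mem_univ _, (Finset.mem_filter.mp hu).2⟩)
  have hclsN : cls.card = ∑ k ∈ keys, (cls.filter fun u => pinKey S d₀ u = k).card :=
    Finset.card_eq_sum_card_fiberwise (f := pinKey S d₀) fun u hu => Finset.mem_image_of_mem _ hu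
  have hkeys_le : (keys.card : ℝ) ≤ (p : ℝ) ^ P * 4 ^ p := by
    have h := card_keys_le S d₀ w
    rw [← hPdef] at h
    have h' : (keys.card : ℝ) ≤ ((p ^ P * 2 ^ (2 * p) : ℕ) : ℝ) := by exact_mod_cast h
    have e4 : ((p ^ P * 2 ^ (2 * p) : ℕ) : ℝ) = (p : ℝ) ^ P * 4 ^ p := by
      push_cast
      rw [pow_mul]; norm_num
    linarith
  have hwin : ((winIn c S w).card : ℝ) ≤ 3 / 4 * (cls.card : ℝ) + (keys.card : ℝ) * err := by
    have h1 : ((winIn c S w).card : ℝ)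
        = ∑ k ∈ keys, (((winIn c S w).filter fun u => pinKey S d₀ u = k).card : ℝ) := by
      exact_mod_cast hwinN
    have h2 : (cls.card : ℝ) = ∑ k ∈ keys, ((cls.filter fun u => pinKey S d₀ u = k).card : ℝ) := by
      exact_mod_cast hclsN
    rw [h1, h2, Finset.mul_sum]
    calc ∑ k ∈ keys, (((winIn c S w).filter fun u => pinKey S d₀ u = k).card : ℝ)
        ≤ ∑ k ∈ keys, (3 / 4 * ((cls.filter fun u => pinKey S d₀ u = k).card : ℝ) + err) :=
          Finset.sum_le_sum hper
      _ = ∑ k ∈ keys, 3 / 4 * ((cls.filter fun u => pinKey S d₀ u = k).card : ℝ) + (keys.card : ℝ) * err := by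
          rw [Finset.sum_add_distrib, Finset.sum_const, nsmul_eq_mul]
  -- total error ≤ 2^n/(16 p) ≤ |cls|/8
  have herr_tot : (keys.card : ℝ) * err ≤ (2 : ℝ) ^ n / (16 * p) := by
    have hx1 : (δ ^ r * K * p) ^ P ≤ 1 := pow_le_one₀ (by positivity) hδrK
    have e3 : (δ ^ r * K * (p : ℝ)) ^ P = (δ ^ r * K) ^ P * (p : ℝ) ^ P := mul_pow _ _ _
    have h0 : 0 ≤ C * 4 ^ p * δ ^ q₀ := by positivity
    have hq : C * 4 ^ p * δ ^ q₀ ≤ 1 / (16 * p) := by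
      have hpos : (0 : ℝ) < (C + 1) * 4 ^ p := by positivity
      have h16 : (C + 1) * 4 ^ p * δ ^ q₀ < 1 / (16 * p) := by
        calc (C + 1) * 4 ^ p * δ ^ q₀ < (C + 1) * 4 ^ p * (1 / (16 * p * (C + 1) * 4 ^ p)) :=
              mul_lt_mul_of_pos_left hq₀ hpos
          _ = 1 / (16 * p) := by field_simp
      have : C * 4 ^ p * δ ^ q₀ ≤ (C + 1) * 4 ^ p * δ ^ q₀ := by
        have : 0 ≤ (4 : ℝ) ^ p * δ ^ q₀ := by positivity
        nlinarith
      linarith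
    calc (keys.card : ℝ) * err ≤ (p : ℝ) ^ P * 4 ^ p * err := mul_le_mul_of_nonneg_right hkeys_le herr0
      _ = C * 4 ^ p * δ ^ q₀ * (δ ^ r * K * p) ^ P * (2 : ℝ) ^ n := by rw [e3, herr]; ring
      _ ≤ C * 4 ^ p * δ ^ q₀ * 1 * (2 : ℝ) ^ n :=
          mul_le_mul_of_nonneg_right (mul_le_mul_of_nonneg_left hx1 h0) (by positivity)
      _ ≤ 1 / (16 * p) * (2 : ℝ) ^ n := by
          rw [mul_one]; exact mul_le_mul_of_nonneg_right hq (by positivity)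
      _ = (2 : ℝ) ^ n / (16 * p) := by ring
  have hcls_ge : (2 : ℝ) ^ n / (2 * p) ≤ (cls.card : ℝ) := by
    have h : |(cls.card : ℝ) - (2 : ℝ) ^ n / p| ≤ ρ ^ n * (2 : ℝ) ^ n := hEq n w
    have hρn : ρ ^ n ≤ 1 / (2 * p) := le_trans (pow_le_pow_of_le_one hρ0 hρ1.le hne) hnₑ.le
    have h' := (abs_le.mp h).1
    have h3 : ρ ^ n * (2 : ℝ) ^ n ≤ 1 / (2 * p) * (2 : ℝ) ^ n := mul_le_mul_of_nonneg_right hρn (by positivity)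
    have e : (2 : ℝ) ^ n / p - 1 / (2 * p) * (2 : ℝ) ^ n = (2 : ℝ) ^ n / (2 * p) := by
      field_simp; ring
    linarith
  calc ((winIn c S w).card : ℝ) ≤ 3 / 4 * (cls.card : ℝ) + (keys.card : ℝ) * err := hwin
    _ ≤ 3 / 4 * (cls.card : ℝ) + (2 : ℝ) ^ n / (16 * p) := by linarith [herr_tot]
    _ ≤ 7 / 8 * (cls.card : ℝ) := by
        have h8 : (2 : ℝ) ^ n / (16 * p) ≤ (cls.card : ℝ) / 8 := by
          have e : (2 : ℝ) ^ n / (16 * p) = ((2 : ℝ) ^ n / (2 * p)) / 8 := by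
            field_simp; ring
          rw [e]; linarith
        linarith

/-- **Skeleton of (G♯), fully decomposed**: R1-local + the two pinned branches give the rung (everything else PROVED here). -/
theorem walkHardFTwoStepFree_of_pinned (p : ℕ) [Fact p.Prime]
    (h₁ : FarLocal p) (h₂ : SparsePinned p) (h₃ : DensePinned p) : WalkHardFTwoStepFree p :=
  walkHardFTwoStepFree_of_regimes p h₁ (nearRegime_of p h₂ h₃)

end NearGlue


/-- the (G♯) rung item signature (tree declarations only) is closed by the skeleton's final theorem by `exact` -/
theorem twoStepFreeRungFive_of (h₁ : FarLocal 5) (h₂ : SparsePinned 5) (h₃ : DensePinned 5) :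
    (∃ θ : ℝ, θ < 1 ∧ ∃ n₀ : ℕ, ∀ n ≥ n₀, ∀ c : ℕ, ∀ y : Fin (n + 1) → (Fin n → Bool) → Bool, (∀ g, ∃ s : ℕ, ∃ α β r : ZMod 5, ∀ u, y g u = decide ((Finset.univ.sum fun i : Fin n => if u i then (if i.val < s then α else β) else 0) = r)) → ((Finset.univ.filter fun u : Fin n → Bool => Summit.QuantumAdvantage.AdviceFreeQNC0.ringWinU c y u = true).card : ℝ) ≤ θ * (2 : ℝ) ^ n) :=
  haveI : Fact (Nat.Prime 5) := ⟨by norm_num⟩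
  walkHardFTwoStepFree_of_pinned 5 h₁ h₂ h₃

end Summit.QuantumAdvantage.AdviceFreeQNC0.LocalEngine
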